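import Summits.HodgeConjecture.HodgeConjecture.Theorems.Ring2AbelianAllAndreFibreClass
import Literature.AlgebraicGeometry.HodgeTheory.HodgeConjectureQbarVoisinProofs
import Literature.AlgebraicGeometry.HodgeTheory.HodgeRiemannPolarizabilityProofs
import Literature.AlgebraicGeometry.HodgeTheory.HodgeFiltrationModelsReductionProofs
import Literature.AlgebraicGeometry.HodgeTheory.ComplexConjugationHolds
import Literature.AlgebraicGeometry.HodgeTheory.GysinKernelWeights
import HarnessLib

/-!
# Ring 2 · sub-cell AbelianAll (ALL ABELIAN VARIETIES), André axis, part VI — the lift nodes (L), (L∀) are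
# CASES OF THE SUMMIT: `HodgeConjecture ⟹ (L∀) ⟹ (L)` proved with NO named fact (the Hodge lift on the
# projective total space), and the Lefschetz column of parts I–V in one statement

HONEST FRAMING (page 1, verbatim): **research route, not a corollary; conditional on HC_CM plus one named
minimal statement.** Cell line: research route conditional on HC_CM; not a corollary; Q11.4-sentence-2
already refuted in dim ≥ 3. Nothing in this file proves a case of the Hodge conjecture. `HC_CM` =
`Theses.RankFourFaces.CMAbelianHodge` (a BINDER, never cited), `HC_AV` = `Theses.PadicSemiregularLift.HodgeAbelianVarieties`,
the item `Theses.RankFourFaces.CMToAbelian` (stmt-16267) is OPEN and not closed here. Seat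
`pub-hodge-ring2-ab-andre-2`, gen 2; owed item o3 of RING2-MAP §AbelianAll AA2.4 ("on-path for (L)/(L∀) from
`HodgeConjecture` needs the Hodge-class lift (Deligne 4.1.2 / CS 11.3.4 semisimplicity) as a fact") — DONE here
WITHOUT a fact: for a class that is already GLOBAL on the projective total space no théorème de la partie fixe
is needed, only the polarisation argument, whose inputs are all PROVED in the tree.

## Content

* §0 `exists_hodgeClass_map_eq` — **the Hodge lift across a morphism `g : Y ⟶ X` of smooth projective
  varieties**: if `g^* W` is a RATIONAL class of type `(p,p)` (for `W ∈ H²ᵖ(X(ℂ); ℂ)` arbitrary), then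
  `g^* W = g^* β` for a RATIONAL `(p,p)` class `β` on `X`. Proof = Voisin 2007 §3 / Charles–Schnell Prop. 11.3.5
  ("there exists a Hodge class `β ∈ Hdg²ᵏ(𝒳̄)` such that `β|_X = α`", the semisimplicity step) on the tree's
  PROVED inputs: rational descent of ranges (`exists_isRationalClass_complexBetti_map_eq`), real Hodge models
  (`exists_isReal_hodgeModel_holds`), `g^*` a morphism of their Hodge structures (`HodgeModel.hodgeStructureHom`,
  with `hodgePQ_independent_of_hodgeModel_holds`), polarisability
  (`smoothProjective_hodgeStructure_isPolarizable_holds`), and `Hdgᵖ ∩ range g^* = g^*(Hdgᵖ)`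
  (`HodgeStructure.Hom.exists_mem_hodgeClasses_eq_of_mem_range`).
* §D ON-PATH, unconditional: `algebraicFixedPart_of_hodgeConjecture : HodgeConjecture → AlgebraicFixedPart` (L∀)
  and `cmFibreAlgebraicLift_of_hodgeConjecture` (L): the Hodge lift for `j_{s₀} : 𝒳_{s₀} ⟶ 𝒳` and the Hodge
  conjecture for the smooth projective `(d+1)`-fold `𝒳`. With parts I/V every André-axis node EXCEPT the
  Lefschetz ones ((5∀), (5), (β∀), (β), (β∃) — operators on `𝒳 × 𝒳`, whose on-path needs the operator-to-class
  bridge of Voisin I Lemma 11.41, not in the tree) is now a CASE of the summit in the kernel: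
  `liftLadder_of_hodgeConjecture`. NOT claimed: `HC_AV ⟹ (L)`/(L∀) (the lift is a cycle on the non-abelian `𝒳`).
* §E `fibreClass_chain` — the Lefschetz column after part V in one statement: (β∀) ⟹ (β) ⟹ (L) ⟹ (4),
  (β∀) ⟹ (L∀) ⟹ (2), (β) ⟹ (3), (β) ⟹[6.3.1] (β∃) ⟹ (T∃); no named transport fact anywhere.

**ERRATUM (gen 2, RING2-MAP §AbelianAll AA2.13; referee finding F-ab-32, docstring-only revision gen 4).** The
part-V nodes (β∀) `FibreClassLefschetzCompactPencils`, (β) `FibreClassLefschetzCMPointedPencils`, (β∃)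
`CMAnchoredPencilFibreClassLefschetz` chained in §E `fibreClass_chain` are **REFUTED-MISSTATED** (their
per-pencil node `FibreClassLefschetzFor` quantifies over all degrees `p`; `not_fibreClassLefschetzFor`, part VIII
`Ring2AbelianAllAndreFibreClassRange`), so the arrows of `fibreClass_chain` OUT OF them are vacuous; they are
**SUPERSEDED** by the repaired nodes (β∀′) `FibreClassLefschetzOnCompactPencils`, (β′)
`FibreClassLefschetzOnCMPointedPencils`, (β∃′) `CMAnchoredPencilFibreClassLefschetzOn` of part VIII, whose
`fibreClassOn_chain` re-proves the same column. Everything else in this file — §0 the Hodge lift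
`exists_hodgeClass_map_eq`, §D `algebraicFixedPart_of_hodgeConjecture` / `liftLadder_of_hodgeConjecture` (the lift
and transport nodes (L∀), (L), (2), (3), (4) are NOT affected), §F the unconditional rungs — stands as stated.

References: Voisin2007HodgeLoci (§3, proof of Prop. 1.2); CharlesSchnell2014Notes (Thm. 11.3.4, Prop. 11.3.5,
Cor. 11.3.6); VoisinHodgeI2002 (§7.1.1–7.1.2, Lemma 7.26, §7.3.2, Lemma 11.41); DeligneHodgeII1971 (4.1.1–4.1.2);
Andre1996Motifs (§5.1, §6.3); Abdulali1994FamiliesAV (Thm. 5.5, §6); HatcherAT2002 (§3.1).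
-/

noncomputable section

set_option linter.dupNamespace false

namespace Summit.HodgeConjecture.HodgeConjecture.Ring2.AbelianAll

open CategoryTheory AlgebraicGeometry
open Literature.AlgebraicGeometry Literature.AlgebraicGeometry.Motives
open Literature.AlgebraicGeometry.HodgeTheory
open Literature.AlgebraicTopology.SingularHomology (singularCohomology)
open Literature.AlgebraicGeometry.Andre1996 (andre1996_cmAnchoredPencil)
open Summit.HodgeConjecture.HodgeConjecture
open Summit.HodgeConjecture.HodgeConjecture.Theses
open Summit.HodgeConjecture.HodgeConjecture.Ring2.Deform (CompactAbelianPencilVHC)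

variable {𝒳 S : SchemeOver ℂ}

/-! ## §0 The Hodge lift on a projective total space (no partie fixe needed) -/

/-- **The Hodge lift across a morphism of smooth projective varieties** (the polarisation argument of
Voisin 2007 §3 / Charles–Schnell Prop. 11.3.5, for a class that is ALREADY global — no théorème de la partie
fixe needed): for `g : Y ⟶ X` with `Y`, `X` smooth projective and `W ∈ H²ᵖ(X(ℂ); ℂ)` whose pull-back `g^* W` is
a RATIONAL class of type `(p,p)` on `Y`, there is a RATIONAL class `β` of type `(p,p)` on `X` with
`g^* β = g^* W`. Proof on the tree's proved inputs: a rational class `ι(x₀)` with the same pull-back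
(`exists_isRationalClass_complexBetti_map_eq`); the Hodge structures of real Hodge models
(`exists_isReal_hodgeModel_holds`), `g^*` a morphism of them (`HodgeModel.hodgeStructureHom`, granted
`hodgePQ_independent_of_hodgeModel_holds`), polarisable (`smoothProjective_hodgeStructure_isPolarizable_holds`);
then `g^* x₀ ∈ Hdgᵖ ∩ range g^* = g^*(Hdgᵖ)` (`HodgeStructure.Hom.exists_mem_hodgeClasses_eq_of_mem_range`).
[cite: Voisin2007HodgeLoci, §3 (proof of Prop. 1.2)] [cite: CharlesSchnell2014Notes, Proposition 11.3.5]
[cite: VoisinHodgeI2002, §7.1.1, §7.1.2 and §7.3.2] -/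
theorem exists_hodgeClass_map_eq {m n : ℕ} {Y X : SchemeOver ℂ} (hY : IsSmoothProjective m Y)
    (hX : IsSmoothProjective n X) (g : Y ⟶ X) {p : ℕ} (W : complexBetti X (2 * p))
    (hrat : IsRationalClass (complexBetti.map g (2 * p) W))
    (hpp : IsOfHodgeType m Y (2 * p) p p (complexBetti.map g (2 * p) W)) :
    ∃ β : complexBetti X (2 * p), IsRationalClass β ∧ IsOfHodgeType n X (2 * p) p p β ∧
      complexBetti.map g (2 * p) β = complexBetti.map g (2 * p) W := by
  -- a rational class with the same pull-back
  obtain ⟨A, hA, hAW⟩ := exists_isRationalClass_complexBetti_map_eq hX g W hrat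
  obtain ⟨x₀, rfl⟩ := hA.exists_ringChange_eq
  -- the Hodge structures of real Hodge models, and `g^*` as a morphism of Hodge structures
  obtain ⟨MX, hMX⟩ := exists_isReal_hodgeModel_holds n X hX
  obtain ⟨MY, hMY⟩ := exists_isReal_hodgeModel_holds m Y hY
  have hI := hodgePQ_independent_of_hodgeModel_holds
  set ιX := singularCohomology.ringChange (algebraMap ℚ ℂ) (ComplexPoints X) (2 * p) with hιX
  set ιY := singularCohomology.ringChange (algebraMap ℚ ℂ) (ComplexPoints Y) (2 * p) with hιY
  set φ := MX.hodgeStructureHom hX hI hMX.isHodgeSymmetric MY hY hMY.isHodgeSymmetric g (2 * p) with hφ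
  have hφx : ∀ x, ιY (φ.toLinearMap x) = complexBetti.map g (2 * p) (ιX x) := fun x ↦ by
    rw [hφ, hιX, hιY]
    exact ringChange_map (AlgPoints.mapContinuous (L := ℂ) g) x
  -- `g^* x₀` is a Hodge class of the fibre-side Hodge structure
  have ha : φ.toLinearMap x₀ ∈ (MY.hodgeStructure hY hMY.isHodgeSymmetric (2 * p)).hodgeClasses p :=
    (MY.mem_hodgeClasses_iff_isOfHodgeType_ringChange hY hI hMY.isHodgeSymmetric p _).2
      (by rw [hφx, hAW]; exact hpp)
  -- the polarisation argument
  haveI : Module.Finite ℚ (singularCohomology ℚ ℚ (ComplexPoints X) (2 * p)) :=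
    finite_singularCohomology_rat_complexPoints hX _
  obtain ⟨x₁, hx₁, hx₁eq⟩ := φ.exists_mem_hodgeClasses_eq_of_mem_range
    (smoothProjective_hodgeStructure_isPolarizable_holds hX MX hMX.isHodgeSymmetric (2 * p))
    (p := (p : ℤ)) (by push_cast; ring) ha (LinearMap.mem_range_self _ x₀)
  refine ⟨ιX x₁, isRationalClass_ringChange x₁,
    (MX.mem_hodgeClasses_iff_isOfHodgeType_ringChange hX hI hMX.isHodgeSymmetric p x₁).1 hx₁, ?_⟩
  rw [← hAW, ← hφx, ← hφx, hx₁eq]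

/-! ## §D On-path of the lift nodes (o3): `HodgeConjecture ⟹ (L∀) ⟹ (L)`, unconditionally -/

/-- **ON-PATH for (L∀): `HodgeConjecture ⟹ AlgebraicFixedPart`, with NO named fact.** For a compact pencil
`f : 𝒳 ⟶ S` and a global `W` with rational `(p,p)` restriction at `s₀`, the Hodge lift of §0
(`exists_hodgeClass_map_eq` for `j_{s₀} : 𝒳_{s₀} ⟶ 𝒳`, both smooth projective) gives a rational `(p,p)` class
`β` on the smooth projective `(d+1)`-fold `𝒳` with `j_{s₀}^* β = j_{s₀}^* W`, and the Hodge conjecture for `𝒳`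
makes `β` algebraic. (The algebraicity premise of (L∀) at `s₀` is not even used: under `HC` every fibrewise-Hodge
global class is fibrewise the restriction of a global algebraic class.) So (L∀), (L) are CASES of the summit.
[cite: CharlesSchnell2014Notes, Proposition 11.3.5 and Corollary 11.3.6] [cite: Voisin2007HodgeLoci, §3] -/
theorem algebraicFixedPart_of_hodgeConjecture (h : _root_.HodgeConjecture) : AlgebraicFixedPart := by
  intro d 𝒳 S f hf p W hW s₀ _
  obtain ⟨β, hβr, hβh, hβW⟩ := exists_hodgeClass_map_eq (hf.isSmoothProjective_fiberOver s₀)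
    hf.isSmoothProjective_total (fiberι f s₀) W (hW s₀).1 (hW s₀).2
  exact ⟨β, (h hf.isSmoothProjective_total).2 p β hβr hβh, hβW⟩

/-- ON-PATH for (L): `HodgeConjecture ⟹ CMFibreAlgebraicLift`. [cite: CharlesSchnell2014Notes, Proposition 11.3.5] -/
theorem cmFibreAlgebraicLift_of_hodgeConjecture (h : _root_.HodgeConjecture) : CMFibreAlgebraicLift :=
  cmFibreAlgebraicLift_of_algebraicFixedPart (algebraicFixedPart_of_hodgeConjecture h)

/-- Under the Hodge conjecture the whole lift/transport ladder of the André axis holds: (L∀), (L), (2), (3),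
(4) (the last three already by deform/part I through `HC_AV`; here through the lift, uniformly). [folklore] -/
theorem liftLadder_of_hodgeConjecture (h : _root_.HodgeConjecture) :
    AlgebraicFixedPart ∧ CMFibreAlgebraicLift ∧ CompactAbelianPencilVHC ∧ CMPointedPencilVHC ∧
      CMAnchoredTransport :=
  have hL := algebraicFixedPart_of_hodgeConjecture h
  ⟨hL, cmFibreAlgebraicLift_of_algebraicFixedPart hL, compactAbelianPencilVHC_of_algebraicFixedPart hL,
    cmPointedPencilVHC_of_compactAbelianPencilVHC (compactAbelianPencilVHC_of_algebraicFixedPart hL),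
    cmAnchoredTransport_of_cmFibreAlgebraicLift (cmFibreAlgebraicLift_of_algebraicFixedPart hL)⟩

/-! ## §E The Lefschetz column of parts I–V in one statement -/

/-- **The Lefschetz column of the sub-cell after this part, in one statement** (each arrow a theorem above or
of parts I–II; `h₂₁` = Lemme 6.3.1): (β∀) ⟹ (β) ⟹ (L) ⟹ (4), (β∀) ⟹ (L∀) ⟹ (2), (β) ⟹ (3), (β) ⟹ (β∃) ⟹ (T∃).
No named transport fact occurs. **ERRATUM: the hypotheses (β∀), (β), (β∃) of part V are REFUTED-MISSTATED
(unbounded `p`; `not_fibreClassLefschetzFor`, part VIII), so the arrows out of them are VACUOUS; SUPERSEDED by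
`fibreClassOn_chain` of part VIII `Ring2AbelianAllAndreFibreClassRange` for the repaired nodes (β∀′), (β′), (β∃′).
Kept for the record.** [cite: Andre1996Motifs, §6.3 (pp. 31–33)] [cite: Abdulali1994FamiliesAV, §5–§6 (pp. 1130–1131)] -/
theorem fibreClass_chain (h₂₁ : andre1996_cmAnchoredPencil) :
    (FibreClassLefschetzCompactPencils → FibreClassLefschetzCMPointedPencils) ∧
      (FibreClassLefschetzCMPointedPencils → CMFibreAlgebraicLift) ∧ (CMFibreAlgebraicLift → CMAnchoredTransport) ∧
      (FibreClassLefschetzCompactPencils → AlgebraicFixedPart) ∧ (AlgebraicFixedPart → CompactAbelianPencilVHC) ∧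
      (FibreClassLefschetzCMPointedPencils → CMPointedPencilVHC) ∧
      (FibreClassLefschetzCMPointedPencils → CMAnchoredPencilFibreClassLefschetz) ∧
      (CMAnchoredPencilFibreClassLefschetz → CMAnchoredPencilTransport) :=
  ⟨fibreClassLefschetzCMPointedPencils_of_compactPencils, cmFibreAlgebraicLift_of_fibreClassLefschetzCMPointedPencils,
    cmAnchoredTransport_of_cmFibreAlgebraicLift, algebraicFixedPart_of_fibreClassLefschetzCompactPencils,
    compactAbelianPencilVHC_of_algebraicFixedPart, cmPointedPencilVHC_of_fibreClassLefschetzCMPointedPencils,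
    cmAnchoredPencilFibreClassLefschetz_of_andre1996_of_cmPointed h₂₁,
    cmAnchoredPencilTransport_of_cmAnchoredPencilFibreClassLefschetz⟩


/-! ## §F Unconditional rungs of the lift nodes (gen 2 addendum; appended, earlier declarations unchanged)

The lift (L∀) asks for an ALGEBRAIC class on the `(d+1)`-dimensional total space; the Hodge lift of §0 reduces it
to the Hodge conjecture ON `𝒳` in the given codimension. Two regimes are therefore THEOREMS: codimension `1` on
every compact pencil (Lefschetz `(1,1)` on `𝒳`, the tree's `lefschetzOneOne_rational_holds`), and every
codimension on pencils of relative dimension `≤ 2` (total space a curve, surface or threefold: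
`hodgeClasses_algebraic_of_dim_le_three_holds`). Compare part IV: TRANSPORT is unconditional up to relative
dimension `3` (HC of the abelian FIBRES), the LIFT only up to `2` in the kernel — at relative dimension `3`,
codimension `2`, the lift is a codimension-2 cycle on a FOURFOLD fibred in abelian threefolds, which the kernel
cannot produce (in print it exists: all fibre classes are algebraic by transport, and the relative Hilbert
scheme spreads them — RING2-MAP AA2.9, owed o8). -/

/-- **(L∀) in codimension 1, unconditionally**: on a compact pencil of abelian varieties, a global degree-2 class
whose fibre restrictions are rational of type `(1,1)` agrees on each fibre with a global ALGEBRAIC (divisor)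
class — the Hodge lift (§0) followed by the Lefschetz theorem on `(1,1)`-classes for the smooth projective total
space. [cite: VoisinHodgeI2002, Thm. 11.30] [cite: CharlesSchnell2014Notes, Proposition 11.3.5] -/
theorem exists_algebraic_lift_codim_one {d : ℕ} {f : 𝒳 ⟶ S} (hf : IsCompactAbelianPencil f d)
    (W : complexBetti 𝒳 (2 * 1)) (s₀ : ComplexPoints S)
    (hrat : IsRationalClass (complexBetti.map (fiberι f s₀) (2 * 1) W))
    (hpp : IsOfHodgeType d (fiberOver f s₀) (2 * 1) 1 1 (complexBetti.map (fiberι f s₀) (2 * 1) W)) :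
    ∃ η ∈ algebraicClasses 𝒳 1,
      complexBetti.map (fiberι f s₀) (2 * 1) η = complexBetti.map (fiberι f s₀) (2 * 1) W := by
  obtain ⟨β, hβr, hβh, hβW⟩ := exists_hodgeClass_map_eq (hf.isSmoothProjective_fiberOver s₀)
    hf.isSmoothProjective_total (fiberι f s₀) W hrat hpp
  exact ⟨β, lefschetzOneOne_rational_holds hf.isSmoothProjective_total β hβr hβh, hβW⟩

/-- **(L∀) in every codimension on compact pencils of relative dimension `≤ 2`, unconditionally** (total space
of dimension `≤ 3`: the Hodge conjecture holds there in every degree — Lefschetz `(1,1)` and hard Lefschetz,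
`hodgeClasses_algebraic_of_dim_le_three_holds`). [cite: VoisinHodgeII2003, §10.2.3 proof of Prop. 10.26]
[cite: CharlesSchnell2014Notes, Proposition 11.3.5] -/
theorem exists_algebraic_lift_of_relDim_le_two {d : ℕ} (hd : d ≤ 2) {f : 𝒳 ⟶ S} (hf : IsCompactAbelianPencil f d)
    {p : ℕ} (W : complexBetti 𝒳 (2 * p)) (s₀ : ComplexPoints S)
    (hrat : IsRationalClass (complexBetti.map (fiberι f s₀) (2 * p) W))
    (hpp : IsOfHodgeType d (fiberOver f s₀) (2 * p) p p (complexBetti.map (fiberι f s₀) (2 * p) W)) :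
    ∃ η ∈ algebraicClasses 𝒳 p,
      complexBetti.map (fiberι f s₀) (2 * p) η = complexBetti.map (fiberι f s₀) (2 * p) W := by
  obtain ⟨β, hβr, hβh, hβW⟩ := exists_hodgeClass_map_eq (hf.isSmoothProjective_fiberOver s₀)
    hf.isSmoothProjective_total (fiberι f s₀) W hrat hpp
  exact ⟨β, hodgeClasses_algebraic_of_dim_le_three_holds (by omega) hf.isSmoothProjective_total p β hβr hβh, hβW⟩

/-- **The lift nodes restricted to relative dimension `≤ 2` are THEOREMS**: for `d ≤ 2` the bodies of
`AlgebraicFixedPart` and `CMFibreAlgebraicLift` hold on every compact pencil of relative dimension `d` (the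
algebraicity premise and the CM point are not used). First open relative dimension of the LIFT in the kernel:
`3` (codimension `2` on a fourfold); of the TRANSPORT (part IV): `4`. [cite: VoisinHodgeII2003, §10.2.3] -/
theorem algebraicFixedPart_body_of_relDim_le_two {d : ℕ} (hd : d ≤ 2) {f : 𝒳 ⟶ S}
    (hf : IsCompactAbelianPencil f d) (p : ℕ) (W : complexBetti 𝒳 (2 * p))
    (hW : ∀ s : ComplexPoints S, IsRationalClass (complexBetti.map (fiberι f s) (2 * p) W) ∧
      IsOfHodgeType d (fiberOver f s) (2 * p) p p (complexBetti.map (fiberι f s) (2 * p) W))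
    (s₀ : ComplexPoints S) :
    ∃ η ∈ algebraicClasses 𝒳 p,
      complexBetti.map (fiberι f s₀) (2 * p) η = complexBetti.map (fiberι f s₀) (2 * p) W :=
  exists_algebraic_lift_of_relDim_le_two hd hf W s₀ (hW s₀).1 (hW s₀).2

end Summit.HodgeConjecture.HodgeConjecture.Ring2.AbelianAll

end
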